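import Summits.ResolutionOfSingularities.ResolutionOfSingularities.Theorems.HilbertSamuelEliminationSigmaMaxModificationsCorridor3WLadderIsoTailsFreeRationalArcLimit
import Summits.ResolutionOfSingularities.ResolutionOfSingularities.Theorems.HilbertSamuelEliminationSigmaMaxModificationsCorridor3WLadderIsoTailsFrameStepOfStalkIdeal
import HarnessLib

/-!
# [OURS · L1 W4.2] D14 / K2-sep ROUTE A, brick (γ) part 2: **K1 À LA CARTE — for towers whose centres are FINITE SETS OF POINTS**
# (the stage data given directly: `𝓘(C_n)_{x_n} = 𝔪_{x_n}`, `H ≡ ν`, a maximal origin AND isolation AT STAGE 1; no `IsIsoPointTower`)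
# (crux `SigmaMaxModifications` stmt-ResolutionOfSingularities-18506 / conjunct stmt-…-19249; line `w_ladder_rows` v8.5, registered stub
# `stub_isoSepRecurrent`; res-L1-w42-plan-1 WORD 2026-08-27T16:25:47Z; design `L/res-L1-w42-stub-2/k2sep/K2SEP-DESIGN.md` §2)

Prover res-L1-w42-stub-2 (gen 5). Helper file `--supports stmt-ResolutionOfSingularities-19249 --as helper`; kernel only, no definitions, no
named fact. OURS (cell res-hironaka, slot W4.2); NOT statements of [Hironaka2017] nor of [CossartJannsenSaito2020] / [CossartPiltant2009].
AI-written; AI review is weaker than expert review.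

WHY. A ground-field base change `T ×_k K` of an isolated point tower (K/k separable algebraic) has centres Spec(κ(x_n) ⊗_k K) = finite
sets of closed points, so it is not an `IsIsoPointTower`; but the arc-limit argument (G2f, `…IsoTailsFreeRationalArcLimit`) reads the
tower only through: the stalks `𝒪_{X_n,x_n}` and the stalk maps, `𝓘(C_n)_{x_n} = 𝔪_{x_n}`, closedness and `H_{X_n}(x_n) = ν` of the
marked points, excellence / dimension of `X_0`, and — for the contradiction — a maximal origin and isolation AT ONE STAGE. This file
re-runs the assembly with exactly these hypotheses.

* `false_of_bennettArc_of_isolated_local` (RING LEVEL: `A` excellent Noetherian local of dim `≤ 3`, closed point isolated in the HS locus of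
  `Spec A`, `A ≃ R⧸I`, formal model + Bennett arc ⟹ `False`) and `false_of_stage_of_bennettArc_of_isolated` — res-type-001's H∞-FINAL-G
  `false_of_isIsoPointTower_of_stage_of_bennettArc` (p533299) with the stage data à la carte: `(X, x)` a maximal origin at level 3 with `x` ISOLATED in `X_max`, `𝒪_{X,x} ≃ R ⧸ I` (`R` regular local), a formal
  model `S ⧸ J ≃ 𝒪̂_{X,x}` and a Bennett arc `P ⊇ J` ⟹ `False` (proof = 001's, with the isolation-in-`Spec 𝒪` step of
  `isIsolatedInHSMaxLocus_spec_stalk_of_isIsoPointTower` inlined).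
* **`false_of_tower_of_forall_freeRational_local`** (every input LOCAL: stage-0 presentation with coefficient field; NEARNESS as the ring
  statement `H^{(0)}[𝒪_{X_{n+1},x_{n+1}}] = H^{(0)}[𝒪_{X_1,x_1}]`; `𝓘(C_n)_{x_n} = 𝔪`; stage-1 stalk excellent of dim ≤ 3 with isolated closed point in
  `Spec 𝒪_{X_1,x_1}` — the shape a ground-field base change delivers stalkwise, cf. `…IsoTailsSeparableBaseChangeLocal`) and **`false_of_tower_of_forall_freeRational`** — K1 à la carte: a `BlowupTower` with marked closed points `x_{n+1} ↦ x_n`, `H_{X_n}(x_n) = ν`,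
  `𝓘(C_n)_{x_n} = 𝔪_{x_n}` (the centre is the reduced point NEAR `x_n` — e.g. a finite set of closed points containing it), a maximal origin
  at stage `0` (presentation with coefficient field) and at stage `1` with `x_1` isolated in `(X_1)_max`, ALL steps rational and
  non-satellite ⟹ `False` (the G2f assembly verbatim over `FormalFrameGen.exists_frameStep_ideal_of_stalkIdeal_eq`).
(The point-tower K1 `false_of_isIsoPointTower_of_forall_freeRational` (p546901) is the special case `hD` from `T.C n = {x_n}`; not
restated here — dedup.)

[OURS · L1 W4.2; AI-written] [cite: CossartPiltant2009, ch. 3 I.9] [cite: HerrmannIkedaOrbanz1988, Thm. (22.24)] [cite: CossartJannsenSaito2020, Def. 6.34, Def. 13.3]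
-/

set_option linter.dupNamespace false

noncomputable section

open CategoryTheory AlgebraicGeometry TopologicalSpace IsLocalRing MvPowerSeries
open Literature.AlgebraicGeometry.Resolution Literature.RingTheory.HilbertSamuel
open Literature.AlgebraicGeometry.CossartJannsenSaito2020
open Summit.ResolutionOfSingularities.ResolutionOfSingularities.Theorems.CampaignW42
open Summit.ResolutionOfSingularities.ResolutionOfSingularities.Theorems.SigmaMaxModificationsCorridor3
open Summit.ResolutionOfSingularities.ResolutionOfSingularities.Cruxes.SigmaMaxModifications
open Summit.ResolutionOfSingularities.ResolutionOfSingularities.Cruxes.SigmaMaxModifications.IdeasL1C4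
open Summit.ResolutionOfSingularities.ResolutionOfSingularities.Cruxes.SigmaMaxModifications.IdeasL1Idea2R4
open Summit.ResolutionOfSingularities.ResolutionOfSingularities.Cruxes.SigmaMaxModifications.IdeasL1C5

namespace Summit.ResolutionOfSingularities.ResolutionOfSingularities.Theorems.SigmaMaxModificationsCorridor3.IsoTailsHS

universe u

/-! ## §1. Isolation passes to `Spec 𝒪_{X,x}` at a maximal origin, and H∞-FINAL-G with the stage data à la carte -/

/-- **Isolation in `Spec 𝒪_{X,x}`** at an isolated point of `X_max` of a maximal origin (finite type over a field ⇒ `H` is upper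
semicontinuous along generizations; then res-type-053's `BlowupTower.isIsolatedInHSMaxLocus_localize` on the constant tower), cf.
`isIsolatedInHSMaxLocus_spec_stalk_of_isIsoPointTower`. [cite: CossartJannsenSaito2020, Def. 13.3, Thm. 2.33 (1)] -/
theorem isIsolatedInHSMaxLocus_spec_stalk_of_isolated {p : ℕ} {ν : ℕ → ℕ} {X : Scheme.{u}} [IsLocallyNoetherian X] {x : X}
    (hO : IsMaximalOrigin p 3 ν X x) (hiso : IsIsolatedInHSMaxLocus X 3 x) :
    IsIsolatedInHSMaxLocus (Spec (X.presheaf.stalk x)) 3 (closedPoint (X.presheaf.stalk x)) := by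
  obtain ⟨k, _, _, f, -, hft, -⟩ := hO.exists_structure
  haveI := hft
  have hsc : ∀ y : X, y ⤳ x → Scheme.hsFun X 3 y ≤ Scheme.hsFun X 3 x :=
    fun y hy => Scheme.hsFun_le_hsFun_of_specializes_over_field f 3 hy
  let T₀ : BlowupTower.{u} :=
    { X := fun _ => X, ln := fun _ => inferInstance, C := fun _ => ∅, isClosed_C := fun _ => isClosed_empty,
      π := fun _ => 𝟙 X, isBlowup := fun _ => Moving.isBlowup_id_vanishingIdeal_empty X }
  exact T₀.isIsolatedInHSMaxLocus_localize x 3 hsc hiso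

/-- **H∞-FINAL-G, RING LEVEL** (res-type-001's `false_of_isIsoPointTower_of_stage_of_bennettArc`, p533299, with the stage read through
its LOCAL RING only): a Noetherian local ring `A` that is EXCELLENT, of dimension `≤ 3`, whose closed point is ISOLATED in the Hilbert–Samuel
locus of `Spec A`, presented as `A ≃ R ⧸ I` by a regular local ring, with a formal model `e′ : S ⧸ J ≃ Â` (`S` regular local) and a prime
`P ⊇ J`, `S ⧸ P` regular of dimension `1`, carrying BENNETT'S EQUALITY `H^{(1)}[(S/J)_{P̄}] = H^{(0)}[S/J]` — is contradictory.
[OURS · L1 W4.2; proof res-type-001's] [cite: CossartJannsenSaito2020, Def. 13.3, Thm. 3.3] [cite: HerrmannIkedaOrbanz1988, Thm. (22.24)] -/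
theorem false_of_bennettArc_of_isolated_local {A : Type u} [CommRing A] [IsLocalRing A] [IsNoetherianRing A]
    (hA : IsExcellentRing A) (hdim : ringKrullDim A ≤ ((3 : ℕ) : WithBot ℕ∞))
    (hisoS : IsIsolatedInHSMaxLocus (Spec (CommRingCat.of A)) 3 (closedPoint A))
    {R : Type u} [CommRing R] [IsRegularLocalRing R] (I : Ideal R) (e : A ≃+* R ⧸ I)
    {S : Type u} [CommRing S] [IsRegularLocalRing S] (J : Ideal S) [IsLocalRing (S ⧸ J)]
    (e' : (S ⧸ J) ≃+* AdicCompletion (maximalIdeal A) A)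
    (P : Ideal S) [P.IsPrime] [IsRegularLocalRing (S ⧸ P)] (hP1 : ringKrullDim (S ⧸ P) = (1 : ℕ)) (hJP : J ≤ P)
    [(P.map (Ideal.Quotient.mk J)).IsPrime]
    (hH : hilbertSamuelFun (Localization.AtPrime (P.map (Ideal.Quotient.mk J))) 1 = hilbertFun (S ⧸ J)) : False := by
  -- (2): isolation in `Spec Â`
  have hisoC := isIsolatedInHSMaxLocus_adicCompletion_of_ringEquiv A hA I e 3 hdim hisoS
  -- (3): transport to `Spec (S ⧸ J)`
  have hisoJ : IsIsolatedInHSMaxLocus (Spec (CommRingCat.of (S ⧸ J))) 3 (closedPoint (S ⧸ J)) :=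
    Moving.isIsolatedInHSMaxLocus_spec_of_iso (A := CommRingCat.of (AdicCompletion (maximalIdeal A) A))
      (B := CommRingCat.of (S ⧸ J)) e'.symm.toCommRingCatIso 3 hisoC
  -- (4): the ROUTE-G end on `S ⧸ J`
  have hcat : IsCatenaryRing (S ⧸ J) := (isCatenaryRing_of_isRegularLocalRing S).quotient J
  let q : (S ⧸ J) ⧸ P.map (Ideal.Quotient.mk J) ≃+* S ⧸ P := DoubleQuot.quotQuotEquivQuotOfLE hJP
  haveI : IsRegularLocalRing ((S ⧸ J) ⧸ P.map (Ideal.Quotient.mk J)) := IsRegularLocalRing.of_ringEquiv q.symm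
  have hr : ringKrullDim ((S ⧸ J) ⧸ P.map (Ideal.Quotient.mk J)) = (1 : ℕ) := by
    rw [ringKrullDim_eq_of_ringEquiv q, hP1]
  have hPm : P.map (Ideal.Quotient.mk J) ≠ maximalIdeal (S ⧸ J) := by
    intro heq
    have hdim1 : ringKrullDim ((S ⧸ J) ⧸ maximalIdeal (S ⧸ J)) = (1 : ℕ) := heq ▸ hr
    letI := Ideal.Quotient.field (maximalIdeal (S ⧸ J))
    rw [ringKrullDim_eq_zero_of_field] at hdim1
    exact absurd hdim1 (by norm_num)
  have hN : minimalPrimesCodim (S ⧸ J) ≤ 3 := by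
    have h1 := minimalPrimesCodim_le_ringKrullDim (S ⧸ J)
    rw [ringKrullDim_eq_of_ringEquiv e', ringKrullDim_adicCompletion] at h1
    exact_mod_cast h1.trans hdim
  exact not_isIsolatedInHSMaxLocus_closedPoint_of_hilbertSamuelFun_eq' hcat (P.map (Ideal.Quotient.mk J)) hPm hr hH hN hisoJ

/-- **H∞-FINAL-G with the stage data à la carte** (the scheme-point form): `(X, x)` a maximal origin at level `3` with `x` ISOLATED in
`X_max` supplies the three local inputs of `false_of_bennettArc_of_isolated_local` (excellence `isExcellent_of_isMaximalOrigin`, `dim 𝒪_{X,x} ≤ 3`,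
isolation in `Spec 𝒪_{X,x}` by `isIsolatedInHSMaxLocus_spec_stalk_of_isolated`). [OURS · L1 W4.2; proof res-type-001's]
[cite: CossartJannsenSaito2020, Def. 13.3, Thm. 3.3] [cite: HerrmannIkedaOrbanz1988, Thm. (22.24)] -/
theorem false_of_stage_of_bennettArc_of_isolated {p : ℕ} {ν : ℕ → ℕ} {X : Scheme.{u}} [IsLocallyNoetherian X] {x : X}
    (hO : IsMaximalOrigin p 3 ν X x) (hiso : IsIsolatedInHSMaxLocus X 3 x)
    {R : Type u} [CommRing R] [IsRegularLocalRing R] (I : Ideal R) (e : ↥(X.presheaf.stalk x) ≃+* R ⧸ I)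
    {S : Type u} [CommRing S] [IsRegularLocalRing S] (J : Ideal S) [IsLocalRing (S ⧸ J)]
    (e' : (S ⧸ J) ≃+* AdicCompletion (maximalIdeal ↥(X.presheaf.stalk x)) ↥(X.presheaf.stalk x))
    (P : Ideal S) [P.IsPrime] [IsRegularLocalRing (S ⧸ P)] (hP1 : ringKrullDim (S ⧸ P) = (1 : ℕ)) (hJP : J ≤ P)
    [(P.map (Ideal.Quotient.mk J)).IsPrime]
    (hH : hilbertSamuelFun (Localization.AtPrime (P.map (Ideal.Quotient.mk J))) 1 = hilbertFun (S ⧸ J)) : False := by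
  have hexc : Scheme.IsExcellent X := isExcellent_of_isMaximalOrigin hO
  have hA : IsExcellentRing (X.presheaf.stalk x) := isExcellentRing_stalk_of_isExcellent hexc x
  have hdim : ringKrullDim (X.presheaf.stalk x) ≤ ((3 : ℕ) : WithBot ℕ∞) := by
    refine le_trans ?_ hO.dim_le
    rw [AlgebraicGeometry.ringKrullDim_stalk_eq_coheight, topologicalKrullDim,
      Order.krullDim_eq_of_orderIso (irreducibleSetEquivPoints (α := X))]
    exact Order.coheight_le_krullDim x
  exact false_of_bennettArc_of_isolated_local hA hdim (isIsolatedInHSMaxLocus_spec_stalk_of_isolated hO hiso) I e J e' P hP1 hJP hH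

/-! ## §2. K1 à la carte -/

set_option maxHeartbeats 3200000 in
-- the stage invariant is a long conjunction over stalks (as in `false_of_isIsoPointTower_of_forall_freeRational`)
/-- **K1 À LA CARTE (finite-point centres allowed).** Let `T` be a tower of blow-ups with marked CLOSED points `x_{n+1} ↦ x_n` such that
`H_{X_n}(x_n) = ν` for all `n`, the centre `C_n` is the reduced point near `x_n` (`𝓘(C_n)_{x_n} = 𝔪_{x_n}` — e.g. `C_n` a finite set of
closed points containing `x_n`), `(X_0, x_0)` and `(X_1, x_1)` are maximal origins at level `3` (characteristic `p`), and `x_1` is ISOLATED in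
`(X_1)_max`. Then the steps cannot ALL be rational and non-satellite. (The arc-limit assembly of `…IsoTailsFreeRationalArcLimit`, verbatim,
over `FormalFrameGen.exists_frameStep_ideal_of_stalkIdeal_eq` and `false_of_stage_of_bennettArc_of_isolated`.) [OURS · L1 W4.2; AI-written]
[cite: CossartPiltant2009, ch. 3 I.9] [cite: HerrmannIkedaOrbanz1988, Thm. (22.24)] -/
theorem false_of_tower_of_forall_freeRational_local {T : BlowupTower.{u}} {pt : ∀ n, T.X n}
    {R₀ : Type u} [CommRing R₀] [IsRegularLocalRing R₀] (k₀ : Subring R₀) (hk₀ : IsField k₀)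
    (σ₀ : R₀ →+* (T.X 0).presheaf.stalk (pt 0)) (hσ₀ : Function.Surjective σ₀)
    (hpt : ∀ n, (T.π n).base (pt (n + 1)) = pt n)
    (hHS : ∀ n, hilbertFun ↥((T.X (n + 1)).presheaf.stalk (pt (n + 1))) = hilbertFun ↥((T.X 1).presheaf.stalk (pt 1)))
    (hD : ∀ n, stalkIdeal (T.centreIdeal n) (pt n) = maximalIdeal ((T.X n).presheaf.stalk (pt n)))
    (hA₁ : IsExcellentRing ↥((T.X 1).presheaf.stalk (pt 1)))
    (hdim₁ : ringKrullDim ↥((T.X 1).presheaf.stalk (pt 1)) ≤ ((3 : ℕ) : WithBot ℕ∞))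
    (hiso₁ : @IsIsolatedInHSMaxLocus (Spec ((T.X 1).presheaf.stalk (pt 1)))
      (by haveI : IsLocallyNoetherian (T.X 1) := T.ln 1; exact inferInstance) 3 (closedPoint ↥((T.X 1).presheaf.stalk (pt 1))))
    (hrat : ∀ n, IsRationalStep T pt n) (hnsat : ∀ n, ¬ IsSatelliteStep T pt n) : False := by
  classical
  haveI : ∀ n, IsLocallyNoetherian (T.X n) := T.ln
  -- (2) a regular system of parameters with (FREE)₀ at index `0`
  obtain ⟨c₀, hc₀⟩ := exists_regularSystemOfParameters (R := R₀)
  obtain ⟨j, hj⟩ := exists_free_index_of_eq (T.isBlowup 0) (pt 1) (pt 0) (hpt 0) (hD 0) rfl c₀ hc₀ σ₀ hσ₀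
  obtain ⟨d, hd⟩ : ∃ d, (maximalIdeal R₀).spanFinrank = d + 1 :=
    ⟨(maximalIdeal R₀).spanFinrank - 1, (Nat.succ_pred_eq_of_pos (Fin.pos j)).symm⟩
  let c : Fin (d + 1) → R₀ := c₀ ∘ finCongr hd.symm
  have hc : Ideal.span (Set.range c) = maximalIdeal R₀ := by
    rw [(finCongr hd.symm).surjective.range_comp]; exact hc₀
  let j' : Fin (d + 1) := finCongr hd j
  have hj' : ∀ i, ((T.π 0).stalkMap (pt (0 + 1))).hom (((T.X 0).presheaf.stalkCongr (.of_eq (hpt 0))).inv (σ₀ (c j'))) ∣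
      ((T.π 0).stalkMap (pt (0 + 1))).hom (((T.X 0).presheaf.stalkCongr (.of_eq (hpt 0))).inv (σ₀ (c i))) := fun i => by
    have h := hj (finCongr hd.symm i)
    simpa [c, j'] using h
  let x : Fin (d + 1) → R₀ := c ∘ Equiv.swap 0 j'
  have hx : Ideal.span (Set.range x) = maximalIdeal R₀ := by
    rw [(Equiv.swap (0 : Fin (d + 1)) j').surjective.range_comp]; exact hc
  have hfree : ∀ i, ((T.π 0).stalkMap (pt (0 + 1))).hom (((T.X 0).presheaf.stalkCongr (.of_eq (hpt 0))).inv (σ₀ (x 0))) ∣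
      ((T.π 0).stalkMap (pt (0 + 1))).hom (((T.X 0).presheaf.stalkCongr (.of_eq (hpt 0))).inv (σ₀ (x i))) := fun i => by
    show ((T.π 0).stalkMap (pt (0 + 1))).hom (((T.X 0).presheaf.stalkCongr (.of_eq (hpt 0))).inv (σ₀ (c (Equiv.swap 0 j' 0)))) ∣
      ((T.π 0).stalkMap (pt (0 + 1))).hom (((T.X 0).presheaf.stalkCongr (.of_eq (hpt 0))).inv (σ₀ (c (Equiv.swap 0 j' i))))
    rw [Equiv.swap_apply_left]
    exact hj' _
  -- (3) the base frame
  obtain ⟨_, -, ψ₀, -, -, -, -, hloc₀, hψx, hres₀⟩ := FormalFrame.exists_baseFrame_of_rsop R₀ k₀ hk₀ hd x hx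
  haveI := hloc₀
  set κ := ResidueField (AdicCompletion (maximalIdeal R₀) R₀) with hκ
  -- (4) THE ITERATION. Stage invariant:
  obtain ⟨P, hP⟩ : ∃ P : ∀ (n : ℕ) (S : Type u) [CommRing S] [IsRegularLocalRing S], (Fin (d + 1) → S) →
      (S →+* (T.X n).presheaf.stalk (pt n)) → (S →+* MvPowerSeries (Fin (d + 1)) κ) → (Fin (d + 1) → κ) → Prop,
      P = fun (n : ℕ) (S : Type u) [CommRing S] [IsRegularLocalRing S] (y : Fin (d + 1) → S)
          (τ : S →+* (T.X n).presheaf.stalk (pt n)) (φ : S →+* MvPowerSeries (Fin (d + 1)) κ) (l : Fin (d + 1) → κ) =>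
        (maximalIdeal S).spanFinrank = d + 1 ∧ Ideal.span (Set.range y) = maximalIdeal S ∧ Function.Surjective τ ∧
        (∀ i, ((T.π n).stalkMap (pt (n + 1))).hom (((T.X n).presheaf.stalkCongr (.of_eq (hpt n))).inv (τ (y 0))) ∣
          ((T.π n).stalkMap (pt (n + 1))).hom (((T.X n).presheaf.stalkCongr (.of_eq (hpt n))).inv (τ (y i)))) ∧
        IsLocalHom φ ∧ φ (y 0) = X 0 ∧
        (∀ i, i ≠ 0 → φ (y i) - X i - C (l i) * X 0 ∈ maximalIdeal (MvPowerSeries (Fin (d + 1)) κ) ^ 2) ∧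
        (∀ a : κ, ∃ r : S, φ r - C a ∈ maximalIdeal (MvPowerSeries (Fin (d + 1)) κ)) := ⟨_, rfl⟩
  obtain ⟨L, hL⟩ : ∃ L : ∀ (n : ℕ) (S : Type u) [CommRing S] (S' : Type u) [CommRing S'],
      (S →+* (T.X n).presheaf.stalk (pt n)) → (S' →+* (T.X (n + 1)).presheaf.stalk (pt (n + 1))) →
      (S →+* MvPowerSeries (Fin (d + 1)) κ) → (S' →+* MvPowerSeries (Fin (d + 1)) κ) → (Fin (d + 1) → S') → Prop,
      L = fun (n : ℕ) (S : Type u) [CommRing S] (S' : Type u) [CommRing S'] (τ : S →+* (T.X n).presheaf.stalk (pt n))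
          (τ' : S' →+* (T.X (n + 1)).presheaf.stalk (pt (n + 1)))
          (φ : S →+* MvPowerSeries (Fin (d + 1)) κ) (φ' : S' →+* MvPowerSeries (Fin (d + 1)) κ) (y' : Fin (d + 1) → S') =>
        ∃ (ι : S →+* S') (c₁ : Fin (d + 1) → κ), (∀ r, φ' (ι r) = subst (SeriesGen.transChartSubst c₁) (φ r)) ∧
          (RingHom.ker τ).map ι ≤ RingHom.ker τ' ∧ (∀ r, y' 0 * r ∈ RingHom.ker τ' → r ∈ RingHom.ker τ') := ⟨_, rfl⟩
  obtain ⟨St, hSt⟩ : ∃ St : ℕ → Type (u + 1), St = fun n =>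
      Σ' (S : Type u) (i : CommRing S) (j : IsRegularLocalRing S) (y : Fin (d + 1) → S) (τ : S →+* (T.X n).presheaf.stalk (pt n))
        (φ : S →+* MvPowerSeries (Fin (d + 1)) κ) (l : Fin (d + 1) → κ), @P n S i j y τ φ l := ⟨_, rfl⟩
  subst hSt
  -- the step: the frame link for finite-point centres
  have hstep : ∀ n (s : (fun n => Σ' (S : Type u) (i : CommRing S) (j : IsRegularLocalRing S) (y : Fin (d + 1) → S)
      (τ : S →+* (T.X n).presheaf.stalk (pt n)) (φ : S →+* MvPowerSeries (Fin (d + 1)) κ) (l : Fin (d + 1) → κ),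
      @P n S i j y τ φ l) n),
      ∃ s' : (fun n => Σ' (S : Type u) (i : CommRing S) (j : IsRegularLocalRing S) (y : Fin (d + 1) → S)
        (τ : S →+* (T.X n).presheaf.stalk (pt n)) (φ : S →+* MvPowerSeries (Fin (d + 1)) κ) (l : Fin (d + 1) → κ),
        @P n S i j y τ φ l) (n + 1),
        @L n s.1 s.2.1 s'.1 s'.2.1 s.2.2.2.2.1 s'.2.2.2.2.1 s.2.2.2.2.2.1 s'.2.2.2.2.2.1 s'.2.2.2.1 := by
    intro n s
    obtain ⟨S, i, j, y, τ, φ, l, hPn⟩ := s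
    rw [hP] at hPn
    obtain ⟨h1, h2, h3, h4, h5, h6, h7, h8⟩ := hPn
    haveI := h5
    obtain ⟨R', i', j', x', σ', ψ', lam', ι, c₁, hr⟩ :=
      FormalFrameGen.exists_frameStep_ideal_of_stalkIdeal_eq T pt n (hD n) (hpt n) (hpt (n + 1)) (hrat n) (hnsat n) h1 y h2 τ h3
        h4 φ h6 l h7 h8
    have hP' : @P (n + 1) R' i' j' x' σ' ψ' lam' := by
      rw [hP]
      exact ⟨hr.1, hr.2.1, hr.2.2.1, hr.2.2.2.2.2.2.2.2.1, hr.2.2.2.2.2.2.2.2.2.1, hr.2.2.2.2.2.2.2.2.2.2.1, hr.2.2.2.2.2.2.2.2.2.2.2.1,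
        hr.2.2.2.2.2.2.2.2.2.2.2.2.1⟩
    have hL' : @L n S i R' i' τ σ' φ ψ' x' := by
      rw [hL]
      exact ⟨ι, c₁, hr.2.2.2.2.2.2.2.2.2.2.2.2.2, hr.2.2.2.1, hr.2.2.2.2.1⟩
    exact ⟨⟨R', i', j', x', σ', ψ', lam', hP'⟩, hL'⟩
  have hP0 : @P 0 R₀ _ _ x σ₀ ψ₀ (fun _ => 0) := by
    rw [hP]
    refine ⟨hd, hx, hσ₀, hfree, hloc₀, hψx 0, fun i _ => ?_, hres₀⟩
    rw [hψx i, map_zero, zero_mul, sub_self, sub_zero]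
    exact Ideal.zero_mem _
  obtain ⟨st, hst0, hst⟩ : ∃ st : ∀ n, (fun n => Σ' (S : Type u) (i : CommRing S) (j : IsRegularLocalRing S) (y : Fin (d + 1) → S)
      (τ : S →+* (T.X n).presheaf.stalk (pt n)) (φ : S →+* MvPowerSeries (Fin (d + 1)) κ) (l : Fin (d + 1) → κ),
      @P n S i j y τ φ l) n,
      st 0 = ⟨R₀, inferInstance, inferInstance, x, σ₀, ψ₀, fun _ => 0, hP0⟩ ∧
        ∀ n, st (n + 1) = Classical.choose (hstep n (st n)) :=
    ⟨fun n => Nat.rec (motive := fun n => (fun n => Σ' (S : Type u) (i : CommRing S) (j : IsRegularLocalRing S)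
        (y : Fin (d + 1) → S) (τ : S →+* (T.X n).presheaf.stalk (pt n)) (φ : S →+* MvPowerSeries (Fin (d + 1)) κ)
        (l : Fin (d + 1) → κ), @P n S i j y τ φ l) n)
      ⟨R₀, inferInstance, inferInstance, x, σ₀, ψ₀, fun _ => 0, hP0⟩ (fun n s => Classical.choose (hstep n s)) n,
      rfl, fun n => rfl⟩
  letI : ∀ n, CommRing (st n).1 := fun n => (st n).2.1
  letI : ∀ n, IsRegularLocalRing (st n).1 := fun n => (st n).2.2.1
  have hlink : ∀ n, ∃ (ι : (st n).1 →+* (st (n + 1)).1) (c₁ : Fin (d + 1) → κ),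
      (∀ r, (st (n + 1)).2.2.2.2.2.1 (ι r) = subst (SeriesGen.transChartSubst c₁) ((st n).2.2.2.2.2.1 r)) ∧
        (RingHom.ker (st n).2.2.2.2.1).map ι ≤ RingHom.ker (st (n + 1)).2.2.2.2.1 ∧
        (∀ r, (st (n + 1)).2.2.2.1 0 * r ∈ RingHom.ker (st (n + 1)).2.2.2.2.1 → r ∈ RingHom.ker (st (n + 1)).2.2.2.2.1) := by
    intro n
    have hs := Classical.choose_spec (hstep n (st n))
    rw [← hst n, hL] at hs
    exact hs
  choose ι c₁ hcomm hker hsat using hlink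
  have hPt : ∀ (n : ℕ) (S : Type u) [CommRing S] [IsRegularLocalRing S] (y : Fin (d + 1) → S)
      (τ : S →+* (T.X n).presheaf.stalk (pt n)) (φ : S →+* MvPowerSeries (Fin (d + 1)) κ) (l : Fin (d + 1) → κ),
      @P n S _ _ y τ φ l →
        (maximalIdeal S).spanFinrank = d + 1 ∧ Ideal.span (Set.range y) = maximalIdeal S ∧ Function.Surjective τ ∧
        IsLocalHom φ ∧ φ (y 0) = X 0 ∧
        (∀ i, i ≠ 0 → φ (y i) - X i - C (l i) * X 0 ∈ maximalIdeal (MvPowerSeries (Fin (d + 1)) κ) ^ 2) ∧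
        (∀ a : κ, ∃ r : S, φ r - C a ∈ maximalIdeal (MvPowerSeries (Fin (d + 1)) κ)) := by
    intro n S _ _ y τ φ l hq
    rw [hP] at hq
    exact ⟨hq.1, hq.2.1, hq.2.2.1, hq.2.2.2.2.1, hq.2.2.2.2.2.1, hq.2.2.2.2.2.2.1, hq.2.2.2.2.2.2.2⟩
  have hclauses : ∀ n, (maximalIdeal (st n).1).spanFinrank = d + 1 ∧
      Ideal.span (Set.range (st n).2.2.2.1) = maximalIdeal (st n).1 ∧ Function.Surjective (st n).2.2.2.2.1 ∧
      IsLocalHom (st n).2.2.2.2.2.1 ∧ (st n).2.2.2.2.2.1 ((st n).2.2.2.1 0) = X 0 ∧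
      (∀ i, i ≠ 0 → (st n).2.2.2.2.2.1 ((st n).2.2.2.1 i) - X i - C ((st n).2.2.2.2.2.2.1 i) * X 0 ∈
        maximalIdeal (MvPowerSeries (Fin (d + 1)) κ) ^ 2) ∧
      (∀ a : κ, ∃ r : (st n).1, (st n).2.2.2.2.2.1 r - C a ∈ maximalIdeal (MvPowerSeries (Fin (d + 1)) κ)) := fun n =>
    @hPt n (st n).1 (st n).2.1 (st n).2.2.1 (st n).2.2.2.1 (st n).2.2.2.2.1 (st n).2.2.2.2.2.1 (st n).2.2.2.2.2.2.1
      (st n).2.2.2.2.2.2.2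
  -- (5) part 2 on the stages `≥ 1` (nearness `hHS` given at the ring level)
  haveI : ∀ n, IsLocalHom (st (n + 1)).2.2.2.2.2.1 := fun n => (hclauses (n + 1)).2.2.2.1
  have hHS' : ∀ n, hilbertFun ((T.X (n + 1)).presheaf.stalk (pt (n + 1))) = hilbertFun ((T.X (0 + 1)).presheaf.stalk (pt (0 + 1))) :=
    fun n => hHS n
  obtain ⟨J, hJloc, e', hJP', hJP, hH⟩ :=
    exists_bennettArc_of_frameTower (K := κ) (d := d) (fun n => (st (n + 1)).1) (fun n => (hclauses (n + 1)).1)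
      (fun n => (st (n + 1)).2.2.2.1) (fun n => (hclauses (n + 1)).2.1)
      (fun n => (T.X (n + 1)).presheaf.stalk (pt (n + 1))) (fun n => (st (n + 1)).2.2.2.2.1) (fun n => (hclauses (n + 1)).2.2.1)
      (fun n => hsat n) (fun n => (st (n + 1)).2.2.2.2.2.1) (fun n => (hclauses (n + 1)).2.2.2.2.1)
      (fun n => (st (n + 1)).2.2.2.2.2.2.1) (fun n => (hclauses (n + 1)).2.2.2.2.2.1) (fun n => (hclauses (n + 1)).2.2.2.2.2.2)
      (fun n => ι (n + 1)) c₁ (fun n r => hcomm (n + 1) r) (fun n => hker (n + 1)) hHS'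
  -- (6) H∞-FINAL-G at stage `1`, along `P₀`, with the stage data à la carte
  haveI := hJloc
  haveI := hJP'
  haveI : IsRegularLocalRing (MvPowerSeries (Fin (d + 1)) κ) := isRegularLocalRing_mvPowerSeries κ (Fin (d + 1))
  haveI : (ArcLimit.arcIdeal d κ).IsPrime := ArcLimit.isPrime_arcIdeal
  haveI : IsRegularLocalRing (MvPowerSeries (Fin (d + 1)) κ ⧸ ArcLimit.arcIdeal d κ) := ArcLimit.isRegularLocalRing_quotient_arcIdeal
  have hP1 : ringKrullDim (MvPowerSeries (Fin (d + 1)) κ ⧸ ArcLimit.arcIdeal d κ) = (1 : ℕ) := by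
    rw [ArcLimit.ringKrullDim_quotient_arcIdeal, Nat.cast_one]
  let e : ↥((T.X (0 + 1)).presheaf.stalk (pt (0 + 1))) ≃+* (st (0 + 1)).1 ⧸ RingHom.ker (st (0 + 1)).2.2.2.2.1 :=
    (RingHom.quotientKerEquivOfSurjective (hclauses (0 + 1)).2.2.1).symm
  exact false_of_bennettArc_of_isolated_local hA₁ hdim₁ hiso₁ (RingHom.ker (st (0 + 1)).2.2.2.2.1) e J e' (ArcLimit.arcIdeal d κ) hP1 hJP hH

/-- **K1 À LA CARTE (finite-point centres allowed), maximal-origin form**: as `false_of_tower_of_forall_freeRational_local`, with the stage-`0`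
presentation produced from a maximal origin at `(X_0, x_0)` (finite type over a field: `exists_regular_presentation_stalk_with_coefficientField`;
excellence, dimension) and the stage-`1` local data from a maximal origin at `(X_1, x_1)` with `x_1` ISOLATED in `(X_1)_max`.
[OURS · L1 W4.2; AI-written] [cite: CossartPiltant2009, ch. 3 I.9] [cite: CossartJannsenSaito2020, Def. 13.3] -/
theorem false_of_tower_of_forall_freeRational {p : ℕ} {ν : ℕ → ℕ} {T : BlowupTower.{u}} {pt : ∀ n, T.X n}
    (hO : IsMaximalOrigin p 3 ν (T.X 0) (pt 0)) (hO₁ : IsMaximalOrigin p 3 ν (T.X 1) (pt 1))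
    (hpt : ∀ n, (T.π n).base (pt (n + 1)) = pt n) (hcl : ∀ n, IsClosed ({pt n} : Set (T.X n)))
    (hHν : ∀ n, Scheme.hsFun (T.X n) 3 (pt n) = ν)
    (hD : ∀ n, stalkIdeal (T.centreIdeal n) (pt n) = maximalIdeal ((T.X n).presheaf.stalk (pt n)))
    (hiso₁ : @IsIsolatedInHSMaxLocus (T.X 1) (T.ln 1) 3 (pt 1))
    (hrat : ∀ n, IsRationalStep T pt n) (hnsat : ∀ n, ¬ IsSatelliteStep T pt n) : False := by
  haveI : ∀ n, IsLocallyNoetherian (T.X n) := T.ln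
  -- stage 0: a presentation with a coefficient field
  obtain ⟨k, _, _, g, -, hft, -⟩ := hO.exists_structure
  haveI := hft
  obtain ⟨R₀, _, _, k₀, hk₀, σ₀, hσ₀⟩ := exists_regular_presentation_stalk_with_coefficientField g (pt 0)
  -- stage 1: the local data
  have hexc₁ : Scheme.IsExcellent (T.X 1) := isExcellent_of_isMaximalOrigin hO₁
  have hdim₁ : ringKrullDim ((T.X 1).presheaf.stalk (pt 1)) ≤ ((3 : ℕ) : WithBot ℕ∞) := by
    refine le_trans ?_ hO₁.dim_le
    rw [AlgebraicGeometry.ringKrullDim_stalk_eq_coheight, topologicalKrullDim,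
      Order.krullDim_eq_of_orderIso (irreducibleSetEquivPoints (α := T.X 1))]
    exact Order.coheight_le_krullDim (pt 1)
  -- nearness along the tower (H1: `X_0` excellent of dimension `≤ 3`, marked closed points with `H ≡ ν`)
  have hHS : ∀ n, hilbertFun ((T.X (n + 1)).presheaf.stalk (pt (n + 1))) = hilbertFun ((T.X 1).presheaf.stalk (pt 1)) := by
    intro n
    have h1 := hilbertSamuelFun_stalk_eq_of_tower (isExcellent_of_isMaximalOrigin hO) hO.dim_le hpt hcl hHν (n + 1) 0
    have h2 := hilbertSamuelFun_stalk_eq_of_tower (isExcellent_of_isMaximalOrigin hO) hO.dim_le hpt hcl hHν 1 0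
    simp only [hilbertSamuelFun_zero] at h1 h2
    rw [h1, h2]
  exact false_of_tower_of_forall_freeRational_local k₀ hk₀ σ₀ hσ₀ hpt hHS hD
    (isExcellentRing_stalk_of_isExcellent hexc₁ (pt 1)) hdim₁ (isIsolatedInHSMaxLocus_spec_stalk_of_isolated hO₁ hiso₁) hrat hnsat

end Summit.ResolutionOfSingularities.ResolutionOfSingularities.Theorems.SigmaMaxModificationsCorridor3.IsoTailsHS

end
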